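import Summits.BirchSwinnertonDyer.BirchSwinnertonDyer.Theorems.ManinLocalTwoThreeShiftRelationDepth
import Summits.BirchSwinnertonDyer.BirchSwinnertonDyer.Theorems.ManinLocalTwoThreeCongruenceHomShiftInvariant
import Summits.BirchSwinnertonDyer.BirchSwinnertonDyer.Theorems.AdditiveKolyvaginRoadManinFrameResidueProperRTameTwistGamma0
import HarnessLib

/-!
# E-es-38 `OddShiftReduction`, part 2/3: conjugation by `Δ_t(L′)` preserves a `tⁿ`-shift-invariant homomorphism on deep
# `t`-congruence elements (the GOOD subgroup contains `Δ_t(L′)` by LEMMA G)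

Summit `BirchSwinnertonDyer`, route `ManinLocalTwoThree` (cell bsd-f2-manin), deciding crux C2 `ManinOddAtFour`
(stmt-BirchSwinnertonDyer-22967), skeleton `kato_shift_two` v6, stub 3 (`C₃` residual; es §25 (N), E-es-38).  For an additive
`u : Γ₀(L) → K` (`L = t^k L′`, `t ∤ L′`) invariant under the `tⁿ`-shift on entries, call `g ∈ SL₂(ℤ[1/t])` GOOD with depth
loss `e` if for every `M ≥ e` and every `γ ∈ Γ₀(L) ∩ Γ(t^M)` there is `γ' ∈ Γ₀(L) ∩ Γ(t^{M−e})` with `ι γ' = g ιγ g⁻¹` and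
`u γ' = u γ` (spelled out in every statement — no definition).  `good_iota`, `good_mul`, `good_shift`, `good_shift'` show
that `{g : g, g⁻¹ GOOD}` is a subgroup containing `ιΓ₀(L)` and stable under the `tⁿ`-shift both ways (shift down,
conjugate, shift up; uniqueness of shifts since `t` is a unit of `ℤ[1/t]`), so by LEMMA G (p1, p600663
`delta_le_of_gamma0Image_le_of_shiftStable`) **`exists_good_of_mem_Delta`**: every element of `Δ_t(L′)` — in particular
`diag(t,t⁻¹)^m` — is GOOD.  Part 3/3 (`…OddShiftReduction.lean`) concludes E-es-38.  No new definitions; nothing about BSD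
or Manin's conjecture is proved here.  References: HOME/MEMO-es.md §25.3 (N); Serre, *Trees*, II.1.4.
-/

set_option autoImplicit false
set_option linter.dupNamespace false

open scoped MatrixGroups

open CongruenceSubgroup Matrix.SpecialLinearGroup Literature.NumberTheory.EllipticCurves.ModularForms
  Literature.NumberTheory.EllipticCurves.ModularForms.HidaCohomology
  Summit.BirchSwinnertonDyer.BirchSwinnertonDyer.Theorems.ConjSpanGenAllLevels

namespace Summit.BirchSwinnertonDyer.BirchSwinnertonDyer.Theorems.ManinLocalTwoThree
/-! ### The conjugation-invariance predicate and its closure properties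

`GOOD g e` (spelled out in each statement, no definition): for every depth `M ≥ e` and every `γ ∈ Γ₀(L) ∩ Γ(t^M)` there is
`γ' ∈ Γ₀(L)` with `ι γ' = g ιγ g⁻¹`, `γ' ∈ Γ(t^{M−e})` and `u γ' = u γ`. -/

section Good

variable (t : ℕ) {L : ℕ} {K : Type*} (u : Gamma0 L → Fin 1 → K)

/-- `GOOD (ι γ₀) 0` for `γ₀ ∈ Γ₀(L)`: `u` is a class function and `Γ(t^M)` is normal. [folklore] -/
theorem good_iota [CommRing K] (hu : u ∈ cocycles 0 L K) (γ₀ : Gamma0 L) :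
    ∀ M : ℕ, 0 ≤ M → ∀ γ : Gamma0 L, (γ : SL(2, ℤ)) ∈ Gamma (t ^ M) →
      ∃ γ' : Gamma0 L, ConjSpanGenAllLevels.iota t (γ' : SL(2, ℤ)) =
          ConjSpanGenAllLevels.iota t (γ₀ : SL(2, ℤ)) * ConjSpanGenAllLevels.iota t (γ : SL(2, ℤ)) *
            (ConjSpanGenAllLevels.iota t (γ₀ : SL(2, ℤ)))⁻¹ ∧
        (γ' : SL(2, ℤ)) ∈ Gamma (t ^ (M - 0)) ∧ u γ' = u γ := by
  intro M _ γ hγ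
  refine ⟨γ₀ * γ * γ₀⁻¹, by simp [map_mul, map_inv], ?_, ?_⟩
  · rw [Nat.sub_zero]
    exact (Gamma_normal (t ^ M)).conj_mem _ hγ γ₀
  · rw [cocycle_zero_mul hu, cocycle_zero_mul hu, cocycle_zero_inv hu]
    abel

/-- `GOOD` is closed under products (depth losses add). [folklore] -/
theorem good_mul {g h : SL(2, Away t)} {e₁ e₂ : ℕ}
    (hg : ∀ M : ℕ, e₁ ≤ M → ∀ γ : Gamma0 L, (γ : SL(2, ℤ)) ∈ Gamma (t ^ M) →
      ∃ γ' : Gamma0 L, ConjSpanGenAllLevels.iota t (γ' : SL(2, ℤ)) = g * ConjSpanGenAllLevels.iota t (γ : SL(2, ℤ)) * g⁻¹ ∧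
        (γ' : SL(2, ℤ)) ∈ Gamma (t ^ (M - e₁)) ∧ u γ' = u γ)
    (hh : ∀ M : ℕ, e₂ ≤ M → ∀ γ : Gamma0 L, (γ : SL(2, ℤ)) ∈ Gamma (t ^ M) →
      ∃ γ' : Gamma0 L, ConjSpanGenAllLevels.iota t (γ' : SL(2, ℤ)) = h * ConjSpanGenAllLevels.iota t (γ : SL(2, ℤ)) * h⁻¹ ∧
        (γ' : SL(2, ℤ)) ∈ Gamma (t ^ (M - e₂)) ∧ u γ' = u γ) :
    ∀ M : ℕ, e₁ + e₂ ≤ M → ∀ γ : Gamma0 L, (γ : SL(2, ℤ)) ∈ Gamma (t ^ M) →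
      ∃ γ' : Gamma0 L, ConjSpanGenAllLevels.iota t (γ' : SL(2, ℤ)) =
          (g * h) * ConjSpanGenAllLevels.iota t (γ : SL(2, ℤ)) * (g * h)⁻¹ ∧
        (γ' : SL(2, ℤ)) ∈ Gamma (t ^ (M - (e₁ + e₂))) ∧ u γ' = u γ := by
  intro M hM γ hγ
  obtain ⟨γ₁, h₁, hd₁, hu₁⟩ := hh M (by omega) γ hγ
  obtain ⟨γ₂, h₂, hd₂, hu₂⟩ := hg (M - e₂) (by omega) γ₁ hd₁
  refine ⟨γ₂, ?_, ?_, hu₂.trans hu₁⟩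
  · rw [h₂, h₁]; group
  · have : M - e₂ - e₁ = M - (e₁ + e₂) := by omega
    rw [← this]; exact hd₂

end Good

/-! ### Shift stability of the predicate -/

section GoodShift

variable (t n k L' : ℕ) {L : ℕ} {K : Type*} (u : Gamma0 L → Fin 1 → K)

/-- `L tⁿ ∣ c` from `L ∣ c` and `t^{k+n} ∣ c` when `L = t^k L′`, `t ∤ L′` (plumbing). [folklore] -/
theorem level_mul_pow_dvd (ht : t.Prime) (hL : L = t ^ k * L') (hL' : ¬ t ∣ L') {c : ℤ} (hLc : (L : ℤ) ∣ c)
    (htc : (t : ℤ) ^ (k + n) ∣ c) : (L : ℤ) * (t : ℤ) ^ n ∣ c := by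
  have hL'L : (L' : ℤ) ∣ (L : ℤ) := ⟨(t : ℤ) ^ k, by rw [hL]; push_cast; ring⟩
  have hL'c : (L' : ℤ) ∣ c := hL'L.trans hLc
  have hcop : IsCoprime (L' : ℤ) ((t : ℤ) ^ (k + n)) :=
    (Nat.isCoprime_iff_coprime.mpr (Nat.Coprime.symm ((Nat.Prime.coprime_iff_not_dvd ht).mpr hL'))).pow_right
  have h := hcop.mul_dvd hL'c htc
  have heq : (L : ℤ) * (t : ℤ) ^ n = (L' : ℤ) * (t : ℤ) ^ (k + n) := by rw [hL]; push_cast; ring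
  rwa [heq]

/-- **Shift stability (`g ↦ diag(tⁿ,1) g diag(tⁿ,1)⁻¹`)**: if `g` is GOOD with depth loss `e` and `g'` is the `tⁿ`-shift of
`g`, then `g'` is GOOD with depth loss `e + 2n + k` — shift `γ` down, conjugate by `g`, shift back up, and compare by
`tⁿ`-shift invariance of `u` (`u(γ') = u(γ)` whenever `γ'` is the `tⁿ`-shift of `γ`). [folklore] -/
theorem good_shift (ht : t.Prime) (hL : L = t ^ k * L') (hL' : ¬ t ∣ L')
    (hsh : ∀ γ γ' : Gamma0 L, ((γ' : SL(2, ℤ)) 0 0 = (γ : SL(2, ℤ)) 0 0 ∧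
      (γ' : SL(2, ℤ)) 0 1 = (t : ℤ) ^ n * (γ : SL(2, ℤ)) 0 1 ∧ (t : ℤ) ^ n * (γ' : SL(2, ℤ)) 1 0 = (γ : SL(2, ℤ)) 1 0 ∧
      (γ' : SL(2, ℤ)) 1 1 = (γ : SL(2, ℤ)) 1 1) → u γ' = u γ)
    {g g' : SL(2, Away t)} {e : ℕ}
    (hg : ∀ M : ℕ, e ≤ M → ∀ γ : Gamma0 L, (γ : SL(2, ℤ)) ∈ Gamma (t ^ M) →
      ∃ γ' : Gamma0 L, ConjSpanGenAllLevels.iota t (γ' : SL(2, ℤ)) = g * ConjSpanGenAllLevels.iota t (γ : SL(2, ℤ)) * g⁻¹ ∧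
        (γ' : SL(2, ℤ)) ∈ Gamma (t ^ (M - e)) ∧ u γ' = u γ)
    (hR : g' 0 0 = g 0 0 ∧ g' 0 1 = (t : Away t) ^ n * g 0 1 ∧ (t : Away t) ^ n * g' 1 0 = g 1 0 ∧ g' 1 1 = g 1 1) :
    ∀ M : ℕ, e + 2 * n + k ≤ M → ∀ γ : Gamma0 L, (γ : SL(2, ℤ)) ∈ Gamma (t ^ M) →
      ∃ γ' : Gamma0 L, ConjSpanGenAllLevels.iota t (γ' : SL(2, ℤ)) = g' * ConjSpanGenAllLevels.iota t (γ : SL(2, ℤ)) * g'⁻¹ ∧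
        (γ' : SL(2, ℤ)) ∈ Gamma (t ^ (M - (e + 2 * n + k))) ∧ u γ' = u γ := by
  intro M hM γ hγ
  have ht0 : t ≠ 0 := ht.ne_zero
  have htZ : (t : ℤ) ≠ 0 := by exact_mod_cast ht0
  have htn : (t : ℤ) ^ n ≠ 0 := pow_ne_zero n htZ
  have hs : IsUnit ((t : Away t) ^ n) := isUnit_natCast_pow (p := t) n
  obtain ⟨-, d2, -, -⟩ := (mem_Gamma_iff_dvd _ _).mp hγ
  -- Step 1: shift `γ` down
  have hb : (t : ℤ) ^ n ∣ (γ : SL(2, ℤ)) 0 1 := by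
    refine (pow_dvd_pow (t : ℤ) (by omega : n ≤ M)).trans ?_
    exact_mod_cast d2
  obtain ⟨X, hX⟩ := exists_shiftRel_down (γ : SL(2, ℤ)) hb
  have hXmem : X ∈ Gamma0 L := mem_Gamma0_of_dvd_apply_one_zero X (by
    rw [← hX.2.2.1]; exact (ManinFrameResidueProperRTameTwist.natCast_dvd_entry10 γ).mul_left _)
  have hXd : X ∈ Gamma (t ^ (M - n)) := mem_Gamma_of_shiftRel' t ht0 (by omega) hX hγ
  have huX : u γ = u ⟨X, hXmem⟩ := hsh ⟨X, hXmem⟩ γ hX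
  -- Step 2: conjugate by `g`
  obtain ⟨γ₂, h₂, hd₂, hu₂⟩ := hg (M - n) (by omega) ⟨X, hXmem⟩ hXd
  -- Step 3: shift back up
  obtain ⟨-, -, e3, -⟩ := (mem_Gamma_iff_dvd _ _).mp hd₂
  have hc₂ : (L : ℤ) * (t : ℤ) ^ n ∣ (γ₂ : SL(2, ℤ)) 1 0 := by
    refine level_mul_pow_dvd t n k L' ht hL hL' (ManinFrameResidueProperRTameTwist.natCast_dvd_entry10 γ₂) ?_
    refine (pow_dvd_pow (t : ℤ) (by omega : k + n ≤ M - n - e)).trans ?_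
    exact_mod_cast e3
  obtain ⟨Y, hY⟩ := exists_shiftRel_up (γ₂ : SL(2, ℤ)) ((dvd_mul_left _ _).trans hc₂)
  have hYmem : Y ∈ Gamma0 L := by
    refine mem_Gamma0_of_dvd_apply_one_zero Y ?_
    obtain ⟨q, hq⟩ := hc₂
    refine ⟨q, mul_left_cancel₀ htn ?_⟩
    rw [hY.2.2.1, hq]; ring
  have hYd : Y ∈ Gamma (t ^ (M - (e + 2 * n + k))) := by
    refine Gamma_pow_le t (by omega : M - (e + 2 * n + k) ≤ M - n - e - n) ?_
    exact mem_Gamma_of_shiftRel t ht0 (by omega) hY hd₂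
  have huY : u ⟨Y, hYmem⟩ = u γ₂ := hsh γ₂ ⟨Y, hYmem⟩ hY
  refine ⟨⟨Y, hYmem⟩, ?_, hYd, by rw [huY, hu₂, ← huX]⟩
  -- Step 4: the conjugation identity by uniqueness of shifts
  have R1 := shiftRel_iota_pow t n hX
  have R3 := shiftRel_mul ((t : Away t) ^ n) (shiftRel_mul ((t : Away t) ^ n) hR R1) (shiftRel_inv ((t : Away t) ^ n) hR)
  rw [← h₂] at R3
  have R4 := shiftRel_iota_pow t n hY
  exact shiftRel_unique ((t : Away t) ^ n) hs R4 R3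

/-- **Inverse shift stability**: if `g` is GOOD with depth loss `e` and `g` is the `tⁿ`-shift of `g'`
(`g' = diag(tⁿ,1)⁻¹ g diag(tⁿ,1)`), then `g'` is GOOD with depth loss `e + 2n + k`. [folklore] -/
theorem good_shift' (ht : t.Prime) (hL : L = t ^ k * L') (hL' : ¬ t ∣ L')
    (hsh : ∀ γ γ' : Gamma0 L, ((γ' : SL(2, ℤ)) 0 0 = (γ : SL(2, ℤ)) 0 0 ∧
      (γ' : SL(2, ℤ)) 0 1 = (t : ℤ) ^ n * (γ : SL(2, ℤ)) 0 1 ∧ (t : ℤ) ^ n * (γ' : SL(2, ℤ)) 1 0 = (γ : SL(2, ℤ)) 1 0 ∧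
      (γ' : SL(2, ℤ)) 1 1 = (γ : SL(2, ℤ)) 1 1) → u γ' = u γ)
    {g g' : SL(2, Away t)} {e : ℕ}
    (hg : ∀ M : ℕ, e ≤ M → ∀ γ : Gamma0 L, (γ : SL(2, ℤ)) ∈ Gamma (t ^ M) →
      ∃ γ' : Gamma0 L, ConjSpanGenAllLevels.iota t (γ' : SL(2, ℤ)) = g * ConjSpanGenAllLevels.iota t (γ : SL(2, ℤ)) * g⁻¹ ∧
        (γ' : SL(2, ℤ)) ∈ Gamma (t ^ (M - e)) ∧ u γ' = u γ)
    (hR : g 0 0 = g' 0 0 ∧ g 0 1 = (t : Away t) ^ n * g' 0 1 ∧ (t : Away t) ^ n * g 1 0 = g' 1 0 ∧ g 1 1 = g' 1 1) :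
    ∀ M : ℕ, e + 2 * n + k ≤ M → ∀ γ : Gamma0 L, (γ : SL(2, ℤ)) ∈ Gamma (t ^ M) →
      ∃ γ' : Gamma0 L, ConjSpanGenAllLevels.iota t (γ' : SL(2, ℤ)) = g' * ConjSpanGenAllLevels.iota t (γ : SL(2, ℤ)) * g'⁻¹ ∧
        (γ' : SL(2, ℤ)) ∈ Gamma (t ^ (M - (e + 2 * n + k))) ∧ u γ' = u γ := by
  intro M hM γ hγ
  have ht0 : t ≠ 0 := ht.ne_zero
  have htZ : (t : ℤ) ≠ 0 := by exact_mod_cast ht0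
  have htn : (t : ℤ) ^ n ≠ 0 := pow_ne_zero n htZ
  have hs : IsUnit ((t : Away t) ^ n) := isUnit_natCast_pow (p := t) n
  obtain ⟨-, -, d3, -⟩ := (mem_Gamma_iff_dvd _ _).mp hγ
  -- Step 1: shift `γ` up
  have hc : (L : ℤ) * (t : ℤ) ^ n ∣ (γ : SL(2, ℤ)) 1 0 := by
    refine level_mul_pow_dvd t n k L' ht hL hL' (ManinFrameResidueProperRTameTwist.natCast_dvd_entry10 γ) ?_
    refine (pow_dvd_pow (t : ℤ) (by omega : k + n ≤ M)).trans ?_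
    exact_mod_cast d3
  obtain ⟨Y, hY⟩ := exists_shiftRel_up (γ : SL(2, ℤ)) ((dvd_mul_left _ _).trans hc)
  have hYmem : Y ∈ Gamma0 L := by
    refine mem_Gamma0_of_dvd_apply_one_zero Y ?_
    obtain ⟨q, hq⟩ := hc
    refine ⟨q, mul_left_cancel₀ htn ?_⟩
    rw [hY.2.2.1, hq]; ring
  have hYd : Y ∈ Gamma (t ^ (M - n)) := mem_Gamma_of_shiftRel t ht0 (by omega) hY hγ
  have huY : u ⟨Y, hYmem⟩ = u γ := hsh γ ⟨Y, hYmem⟩ hY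
  -- Step 2: conjugate by `g`
  obtain ⟨γ₂, h₂, hd₂, hu₂⟩ := hg (M - n) (by omega) ⟨Y, hYmem⟩ hYd
  -- Step 3: shift back down
  obtain ⟨-, e2, -, -⟩ := (mem_Gamma_iff_dvd _ _).mp hd₂
  have hb₂ : (t : ℤ) ^ n ∣ (γ₂ : SL(2, ℤ)) 0 1 := by
    refine (pow_dvd_pow (t : ℤ) (by omega : n ≤ M - n - e)).trans ?_
    exact_mod_cast e2
  obtain ⟨X, hX⟩ := exists_shiftRel_down (γ₂ : SL(2, ℤ)) hb₂
  have hXmem : X ∈ Gamma0 L := mem_Gamma0_of_dvd_apply_one_zero X (by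
    rw [← hX.2.2.1]; exact (ManinFrameResidueProperRTameTwist.natCast_dvd_entry10 γ₂).mul_left _)
  have hXd : X ∈ Gamma (t ^ (M - (e + 2 * n + k))) := by
    refine Gamma_pow_le t (by omega : M - (e + 2 * n + k) ≤ M - n - e - n) ?_
    exact mem_Gamma_of_shiftRel' t ht0 (by omega) hX hd₂
  have huX : u γ₂ = u ⟨X, hXmem⟩ := hsh ⟨X, hXmem⟩ γ₂ hX
  refine ⟨⟨X, hXmem⟩, ?_, hXd, by rw [← huX, hu₂, huY]⟩
  -- Step 4
  have R1 := shiftRel_iota_pow t n hY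
  have R3 := shiftRel_mul ((t : Away t) ^ n) (shiftRel_mul ((t : Away t) ^ n) hR R1) (shiftRel_inv ((t : Away t) ^ n) hR)
  rw [← h₂] at R3
  have R4 := shiftRel_iota_pow t n hX
  exact shiftRel_unique' ((t : Away t) ^ n) hs R4 R3

end GoodShift

/-! ### Every element of `Δ_t(L′)` is GOOD (LEMMA G) -/

section GoodDelta

variable (t n k L' : ℕ) {L : ℕ} {K : Type*} [CommRing K] (u : Gamma0 L → Fin 1 → K)

/-- **Conjugation by any element of `Δ_t(L′)` preserves `u` on deep congruence elements.**  For a `tⁿ`-shift-invariant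
additive `u : Γ₀(L) → K` (`L = t^k L′`, `t ∤ L′`, `n ≥ 1`), the set of `g ∈ SL₂(ℤ[1/t])` such that `g` and `g⁻¹` are GOOD
(conjugation by `g` sends deep elements of `Γ₀(L)` to elements of `Γ₀(L)` with the same `u`-value, with bounded loss of
`t`-adic depth) is a subgroup containing `ι Γ₀(L)` and stable under the `tⁿ`-shift and its inverse; by LEMMA G
(`delta_le_of_gamma0Image_le_of_shiftStable`, p1) it contains `Δ_t(L′)`. [folklore] -/
theorem exists_good_of_mem_Delta (ht : t.Prime) (hn : 1 ≤ n) (hL : L = t ^ k * L') (hL' : ¬ t ∣ L')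
    (hu : u ∈ cocycles 0 L K)
    (hsh : ∀ γ γ' : Gamma0 L, ((γ' : SL(2, ℤ)) 0 0 = (γ : SL(2, ℤ)) 0 0 ∧
      (γ' : SL(2, ℤ)) 0 1 = (t : ℤ) ^ n * (γ : SL(2, ℤ)) 0 1 ∧ (t : ℤ) ^ n * (γ' : SL(2, ℤ)) 1 0 = (γ : SL(2, ℤ)) 1 0 ∧
      (γ' : SL(2, ℤ)) 1 1 = (γ : SL(2, ℤ)) 1 1) → u γ' = u γ)
    {g : SL(2, Away t)} (hgΔ : g ∈ Delta t L') :
    ∃ e : ℕ, ∀ M : ℕ, e ≤ M → ∀ γ : Gamma0 L, (γ : SL(2, ℤ)) ∈ Gamma (t ^ M) →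
      ∃ γ' : Gamma0 L, ConjSpanGenAllLevels.iota t (γ' : SL(2, ℤ)) = g * ConjSpanGenAllLevels.iota t (γ : SL(2, ℤ)) * g⁻¹ ∧
        (γ' : SL(2, ℤ)) ∈ Gamma (t ^ (M - e)) ∧ u γ' = u γ := by
  -- the subgroup of elements `g` such that `g` and `g⁻¹` are GOOD
  let P : SL(2, Away t) → Prop := fun g ↦ ∃ e : ℕ, ∀ M : ℕ, e ≤ M → ∀ γ : Gamma0 L, (γ : SL(2, ℤ)) ∈ Gamma (t ^ M) →
      ∃ γ' : Gamma0 L, ConjSpanGenAllLevels.iota t (γ' : SL(2, ℤ)) = g * ConjSpanGenAllLevels.iota t (γ : SL(2, ℤ)) * g⁻¹ ∧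
        (γ' : SL(2, ℤ)) ∈ Gamma (t ^ (M - e)) ∧ u γ' = u γ
  have hPmul : ∀ g h, P g → P h → P (g * h) := fun g h ⟨e₁, hg⟩ ⟨e₂, hh⟩ ↦ ⟨e₁ + e₂, good_mul t u hg hh⟩
  have hPiota : ∀ γ₀ : Gamma0 L, P (ConjSpanGenAllLevels.iota t (γ₀ : SL(2, ℤ))) := fun γ₀ ↦ ⟨0, good_iota t u hu γ₀⟩
  have hPone : P 1 := by
    have h := hPiota 1
    rwa [Subgroup.coe_one, map_one] at h
  let H : Subgroup SL(2, Away t) :=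
    { carrier := {g | P g ∧ P g⁻¹}
      mul_mem' := fun {g h} hg hh ↦ ⟨hPmul g h hg.1 hh.1, by rw [mul_inv_rev]; exact hPmul _ _ hh.2 hg.2⟩
      one_mem' := ⟨hPone, by rw [inv_one]; exact hPone⟩
      inv_mem' := fun {g} hg ↦ ⟨hg.2, by rw [inv_inv]; exact hg.1⟩ }
  have hmem : ∀ g : SL(2, Away t), g ∈ H ↔ P g ∧ P g⁻¹ := fun g ↦ Iff.rfl
  have hΓ : gamma0Image t (t ^ k * L') ≤ H := by
    rw [← hL]
    rintro _ ⟨γ₀, hγ₀, rfl⟩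
    refine (hmem _).mpr ⟨hPiota ⟨γ₀, hγ₀⟩, ?_⟩
    rw [← map_inv]
    exact hPiota ⟨γ₀, hγ₀⟩⁻¹
  have hS : ∀ g ∈ H, ∀ g' : SL(2, Away t), g' 0 0 = g 0 0 → g' 0 1 = (t : Away t) ^ n * g 0 1 →
      (t : Away t) ^ n * g' 1 0 = g 1 0 → g' 1 1 = g 1 1 → g' ∈ H := by
    intro g hg g' h1 h2 h3 h4
    obtain ⟨⟨e, hge⟩, ⟨f, hgf⟩⟩ := (hmem g).mp hg
    refine (hmem g').mpr ⟨⟨e + 2 * n + k, good_shift t n k L' u ht hL hL' hsh hge ⟨h1, h2, h3, h4⟩⟩,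
      ⟨f + 2 * n + k, good_shift t n k L' u ht hL hL' hsh hgf (shiftRel_inv _ ⟨h1, h2, h3, h4⟩)⟩⟩
  have hS' : ∀ g ∈ H, ∀ g' : SL(2, Away t), g' 0 0 = g 0 0 → (t : Away t) ^ n * g' 0 1 = g 0 1 →
      g' 1 0 = (t : Away t) ^ n * g 1 0 → g' 1 1 = g 1 1 → g' ∈ H := by
    intro g hg g' h1 h2 h3 h4
    obtain ⟨⟨e, hge⟩, ⟨f, hgf⟩⟩ := (hmem g).mp hg
    have hR : g 0 0 = g' 0 0 ∧ g 0 1 = (t : Away t) ^ n * g' 0 1 ∧ (t : Away t) ^ n * g 1 0 = g' 1 0 ∧ g 1 1 = g' 1 1 :=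
      ⟨h1.symm, h2.symm, h3.symm, h4.symm⟩
    refine (hmem g').mpr ⟨⟨e + 2 * n + k, good_shift' t n k L' u ht hL hL' hsh hge hR⟩,
      ⟨f + 2 * n + k, good_shift' t n k L' u ht hL hL' hsh hgf (shiftRel_inv _ hR)⟩⟩
  haveI : NeZero t := ⟨ht.ne_zero⟩
  have hΔ : Delta t L' ≤ H := delta_le_of_gamma0Image_le_of_shiftStable H ht hn hL' k hΓ hS hS'
  exact ((hmem g).mp (hΔ hgΔ)).1

end GoodDelta

end Summit.BirchSwinnertonDyer.BirchSwinnertonDyer.Theorems.ManinLocalTwoThree
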